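import Literature.NumberTheory.GaloisRepresentations.LocalEulerPoincareCharacteristic
import Literature.NumberTheory.GaloisRepresentations.LocalDualityTwoZero
import Literature.NumberTheory.GaloisRepresentations.ContinuousH1TrivialAction
import HarnessLib

/-!
# LP-D (local count): the number of continuous homomorphisms `Γ_F → A₀` of a `p`-adic field into a
# finite group, from Tate's local Euler–Poincaré characteristic and local duality in bidegree
# `(2,0)` (cell `b2b-bsdres`, unit `b2b-bsdres-eisenstein-p1`, gen 20; X1R0-GAPMAP §28.4 (LP-D), §29)

HONEST FRAMING (run/shared/lean/b2b/bsd-rank1-residual/, verbatim in every file): the goal of the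
cell is to DELETE the COMBINATION-SHAPED residual classes of the Birch–Swinnerton-Dyer formula for
ALL analytic-rank `≤ 1` elliptic curves over `ℚ` — "full BSD formula for every rank `≤ 1` curve in
class `C`" assembled STRICTLY from published theorems — so that the rank-`≤ 1` remainder becomes
exactly the CONSTRUCTION-SHAPED classes, which are TYPED (missing-input `Prop`s), NOT attempted.
This is not "finishing BSD". Sub-cell `b2b-bsdres-eisenstein-p1`: research route; NO CLAIM BEYOND
STATED CLASSES; nothing here changes a label; nothing is booked. THEOREMS ONLY — no definition, no
named fact introduced; Tate's local Euler–Poincaré characteristic formula (the tree's named fact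
`localEulerPoincareCharacteristic`, Milne *ADT* I Thm. 2.8) is a HYPOTHESIS (`hEP`); local duality
in bidegree `(2,0)` is the tree's THEOREM `natCard_two_eq_natCard_invariants_homRep`.

## What and why

The index bound of the local package (`X1/StrictClassesIndex.exists_addSubgroup_strict`) is stated
against `#Z¹(Γ, A₀)`, the number of continuous crossed homomorphisms of the TRIVIAL module `A₀` —
i.e. of continuous homomorphisms `Γ → A₀`. For `Γ = Γ_F` the absolute Galois group of a
non-archimedean local field of characteristic `0` and `A₀` finite (in the application `A₀ = Ẽ[p]`,
of order `p`):

* `natCard_contOneCocycles_trivial_eq` — **`#Z¹(Γ_F, A₀) = #A₀ · #H²(F, A₀) · #(𝒪_F / #A₀)`**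
  (`H¹ = Z¹` for a trivial module, `H⁰ = A₀`, and `hEP`);
* `natCard_two_trivial_eq_one` — **`#H²(F, A₀) = 1`** when `p^k A₀ = 0` and `\bar F` has NO
  non-trivial `Γ_F`-fixed `p^k`-th root of unity (duality `(2,0)`: `#H²(F, A₀) = #Hom_{Γ_F}(A₀, μ_{p^k})`,
  and an equivariant `f : A₀ → μ_{p^k}` out of a trivial module takes `Γ_F`-fixed values);
* `natCard_contOneCocycles_trivial_eq_of_forall_mu` — hence **`#Z¹(Γ_F, A₀) = #A₀ · #(𝒪_F / #A₀)`**.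

(For `F = (ℚ_n)_𝔭`, `p` odd, there is no `Γ_F`-fixed primitive `p`-th root of unity: the
cyclotomic character of the inertia at `p` over `ℚ_n` still takes values outside `1 + pℤ_p` — the
assembly file discharges the hypothesis.)

References: [MilneADT2006] I Thm. 2.8, Cor. 2.3; [SerreGaloisCohomology1997] II §5.2 Thm. 2,
II §5.7 Thm. 5; [GreenbergLNM1716] §3 Lemma 3.4.
-/

noncomputable section

open scoped Classical
open Function CategoryTheory Field IsNonarchimedeanLocalField ValuativeRel
open Literature.NumberTheory.GaloisRepresentations
open Literature.NumberTheory.GaloisRepresentations.DiscreteGaloisModule (mu MuCarrier)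

universe u

set_option autoImplicit false

namespace Summit.BirchSwinnertonDyer.Rank1Residual.X1.LocalTrivialCocyclesCount

open _root_.TopRep _root_.ContinuousCohomology

variable (F : Type u) [Field F] [ValuativeRel F] [TopologicalSpace F] [IsNonarchimedeanLocalField F]
  [CharZero F]
  (A₀ : Type u) [AddCommGroup A₀] [TopologicalSpace A₀] [DiscreteTopology A₀] [Finite A₀]

/-! ## §1. `H⁰` and `H¹` of the trivial module -/

omit [ValuativeRel F] [TopologicalSpace F] [IsNonarchimedeanLocalField F] [CharZero F] [Finite A₀] in
/-- Every element of the trivial module is invariant: `#H⁰(Γ_F, A₀) = #A₀`. [folklore] -/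
theorem natCard_invariants_trivial :
    Nat.card (ContinuousRep.trivial (absoluteGaloisGroup F) ℤ A₀).toTopRep.ρ.invariants =
      Nat.card A₀ :=
  Nat.card_congr (Equiv.subtypeUnivEquiv fun x ↦ by
    rw [ContRepresentation.mem_invariants]
    intro g
    rfl)

omit [TopologicalSpace F] [IsNonarchimedeanLocalField F] [CharZero F] in
/-- **`#Z¹(Γ_F, A₀) = #A₀ · #H²(F, A₀) · #(𝒪_F / #A₀ 𝒪_F)`** for the trivial module `A₀`: Tate's
local Euler–Poincaré characteristic `#H⁰ · #H² · #(𝒪/#A₀) = #H¹` with `H⁰ = A₀` and `H¹ = Z¹`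
(`natCard_continuousCohomology_one_eq_of_trivial`); also the finiteness of `Z¹` and `H²`.
[cite: MilneADT2006, Ch. I §2, Thm. 2.8 (p. 31)] [cite: SerreGaloisCohomology1997, II §5.7 Thm. 5] -/
theorem natCard_contOneCocycles_trivial_eq (hEP : localEulerPoincareCharacteristic F) :
    Finite (contOneCocycles (ContinuousRep.trivial (absoluteGaloisGroup F) ℤ A₀).toTopRep) ∧
    Finite (continuousCohomology 2 (ContinuousRep.trivial (absoluteGaloisGroup F) ℤ A₀).toTopRep) ∧
    Nat.card (contOneCocycles (ContinuousRep.trivial (absoluteGaloisGroup F) ℤ A₀).toTopRep) =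
      Nat.card A₀ *
        Nat.card (continuousCohomology 2 (ContinuousRep.trivial (absoluteGaloisGroup F) ℤ A₀).toTopRep) *
        Nat.card (𝒪[F] ⧸ Ideal.span {((Nat.card A₀ : ℕ) : 𝒪[F])}) := by
  obtain ⟨h1, h2, hEP'⟩ := hEP (ContinuousRep.trivial (absoluteGaloisGroup F) ℤ A₀)
  have htriv : ∀ (g : absoluteGaloisGroup F)
      (x : (ContinuousRep.trivial (absoluteGaloisGroup F) ℤ A₀).toTopRep),
      (ContinuousRep.trivial (absoluteGaloisGroup F) ℤ A₀).toTopRep.ρ g x = x := fun _ _ ↦ rfl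
  have hZH := natCard_continuousCohomology_one_eq_of_trivial _ htriv
  haveI := h1
  have hfinZ : Finite (contOneCocycles (ContinuousRep.trivial (absoluteGaloisGroup F) ℤ A₀).toTopRep) :=
    Finite.of_injective _ (oneCocycleClass_injective_of_trivial _ htriv)
  refine ⟨hfinZ, h2, ?_⟩
  rw [← hZH, ← hEP', natCard_invariants_trivial]

/-! ## §2. `H²` of the trivial module vanishes when `\bar F` has no fixed `p^k`-th roots of unity -/

/-- **`#H²(F, A₀) = 1`** for a finite trivial module `A₀` killed by `p^k`, provided no non-trivial
`p^k`-th root of unity of `\bar F` is fixed by `Γ_F`: by local duality in bidegree `(2,0)`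
(`natCard_two_eq_natCard_invariants_homRep`) `#H²(F, A₀) = #Hom_{Γ_F}(A₀, μ_{p^k})`, and an
equivariant map out of the trivial module `A₀` has `Γ_F`-fixed values, hence is `0`.
[cite: SerreGaloisCohomology1997, II §5.2 Thm. 2] [cite: MilneADT2006, I Cor. 2.3] -/
theorem natCard_two_trivial_eq_one {p k : ℕ} [Fact p.Prime] (hA : ∀ a : A₀, p ^ k • a = 0)
    (hμ : ∀ ζ : MuCarrier F (p ^ k),
      (∀ σ : absoluteGaloisGroup F, mu F (p ^ k) σ ζ = ζ) → ζ = 0) :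
    Nat.card (continuousCohomology 2 (ContinuousRep.trivial (absoluteGaloisGroup F) ℤ A₀).toTopRep) =
      1 := by
  obtain ⟨-, h⟩ := natCard_two_eq_natCard_invariants_homRep F
    (ContinuousRep.trivial (absoluteGaloisGroup F) ℤ A₀) hA
  rw [h, Nat.card_eq_one_iff_exists]
  refine ⟨⟨0, by rw [ContRepresentation.mem_invariants]; intro g; exact map_zero _⟩, ?_⟩
  rintro ⟨f, hf⟩
  apply Subtype.ext
  change f = 0
  rw [ContRepresentation.mem_invariants] at hf
  refine HomCarrier.ext fun a ↦ ?_
  refine hμ (f a) fun σ ↦ ?_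
  have h1 := (ContinuousRep.homRep_apply_eq_self_iff
    (ContinuousRep.trivial (absoluteGaloisGroup F) ℤ A₀) (mu F (p ^ k)) σ f).mp (hf σ) a
  rwa [ContinuousRep.trivial_apply] at h1

/-- **`#Z¹(Γ_F, A₀) = #A₀ · #(𝒪_F / #A₀ 𝒪_F)`** (continuous homomorphisms `Γ_F → A₀`) for a finite
group `A₀` killed by `p^k`, `F` a non-archimedean local field of characteristic `0` whose algebraic
closure has no non-trivial `Γ_F`-fixed `p^k`-th root of unity, GIVEN Tate's local Euler–Poincaré
characteristic (`hEP`). [cite: MilneADT2006, Ch. I §2, Thm. 2.8 (p. 31), Cor. 2.3] -/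
theorem natCard_contOneCocycles_trivial_eq_of_forall_mu (hEP : localEulerPoincareCharacteristic F)
    {p k : ℕ} [Fact p.Prime] (hA : ∀ a : A₀, p ^ k • a = 0)
    (hμ : ∀ ζ : MuCarrier F (p ^ k),
      (∀ σ : absoluteGaloisGroup F, mu F (p ^ k) σ ζ = ζ) → ζ = 0) :
    Finite (contOneCocycles (ContinuousRep.trivial (absoluteGaloisGroup F) ℤ A₀).toTopRep) ∧
    Nat.card (contOneCocycles (ContinuousRep.trivial (absoluteGaloisGroup F) ℤ A₀).toTopRep) =
      Nat.card A₀ * Nat.card (𝒪[F] ⧸ Ideal.span {((Nat.card A₀ : ℕ) : 𝒪[F])}) := by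
  obtain ⟨hfin, -, h⟩ := natCard_contOneCocycles_trivial_eq F A₀ hEP
  refine ⟨hfin, ?_⟩
  rw [h, natCard_two_trivial_eq_one F A₀ hA hμ, mul_one]

end Summit.BirchSwinnertonDyer.Rank1Residual.X1.LocalTrivialCocyclesCount

end
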